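import Summits.QuantumFields.BalabanUV.Beta.EriceFlowEnclosureLogMeanClockIntegral

/-!
# Beta / EriceFlowEnclosureUnitStepTailLaw — SERVICE FOR THE SECOND-ORDER TAIL LAW ALONG AN ALMOST-UNIT-STEP SEQUENCE (P2 #56d-B, part 1 of 2;
# abstract service for the bare-side sharpness witness): the TRAPEZOID identity `s(g(a)+g(b))∕2 − ∫_a^b g = ½∫_a^b (x−a)(b−x)g″` by ONE application
# of the fundamental theorem (derivative of `(x−a)(b−x)g′ + (2x−a−b)g`), its error `≤ s³ sup|g″|∕2`; the LEFT-ENDPOINT identity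
# `s·G(a) − ∫_a^b G = ∫_a^b (x−b)G′` with error `≤ s² sup|G′|`; and the elementary calculus of sequences `u_j` with steps
# `s_j = u_{j+1} − u_j ∈ [1∕2, 2]`, `u_0 ≥ 1`: `u_j ≥ 1 + j∕2`, the cubic telescope `1∕(9u_j³) ≤ 1∕u_j² − 1∕u_{j+1}²` (so `Σ_{j≥K} 1∕u_j³ ≤ 9∕u_K²`),
# the quadratic telescope `1∕(6u_j²) ≤ 1∕u_j − 1∕u_{j+1}` (so `Σ_{j≥K} 1∕u_j² ≤ 6∕u_K`), `Σ_{K<N} 1∕u_K ≤ 2H_N`, `u_j → ∞`.  The tail law itself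
# (`|Σ_{j>K} g(u_j) − F(u_K)| ≤ A∕u_K²`) and the first-order sum law are P2 #56d-B part 2 (`…UnitStepTailLawEnd`).  Pure [folklore].
#   §1 `trapezoid_identity`, `trapezoid_error_le`; §2 `leftEndpoint_identity`, `leftEndpoint_error_le`;
#   §3 `step_lower`, `u_pos`, `u_one_le`, `u_succ_le_three_mul`, `u_mono`, `inv_sq_telescope`, `sum_inv_cube_le`, `inv_telescope`, `sum_inv_sq_le`,
#      `sum_inv_le_harmonic`, `u_tendsto_atTop`.
# (β-flow team, prover 2 = lower ∕ positivity side, unit `b2b-balaban-beta-bflow-p2`, gen 39; module P2 #56d-B1; no Erice sentence occurs)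

HONEST FRAMING (page 1 of everything the β sub-cell writes): discharging `BetaPertH` makes Bałaban's UV stability UNCONDITIONAL — a
real constructive-QFT result; it is NOT the continuum limit and NOT the Clay problem.  HONEST DEPENDENCY (cell reorg 2026-08-19,
verbatim): «continuum YM on T⁴ ⇐ BetaPertH ∧ nine spine estimates (0/9 proved); BetaPertH ⇐ (D1) ∧ (D4) ∧ CAP+tail; G-an2-4 gates
asym, D1 and NE2/3/4.»  THIS MODULE DISCHARGES NOTHING and quotes nothing: [folklore] real analysis on abstract data (g, G, u).

WHAT THIS FILE PROVES (0 sorry, 0 def): §1 `trapezoid_identity`, `trapezoid_error_le`; §2 `leftEndpoint_identity`, `leftEndpoint_error_le`;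
§3 `step_lower`, `u_pos`, `u_one_le`, `u_succ_le_three_mul`, `u_mono`, `inv_sq_telescope`, `sum_inv_cube_le`, `inv_telescope`, `sum_inv_sq_le`,
`sum_inv_le_harmonic`, `u_tendsto_atTop`.
NOT CLAIMED: the tail law (part 2); anything on (3.62) ∕ β (P2 #56d-C); `BetaPertH`; continuum; Clay.
-/

namespace Summit.QuantumFields.BalabanUV.Beta.EriceFlowEnclosureUnitStepTailLaw

open Set Filter Topology MeasureTheory intervalIntegral Finset

noncomputable section

variable {g g₁ g₂ G G₁ : ℝ → ℝ} {u : ℕ → ℝ}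
/-! ## §1 The trapezoid rule with its error, by one application of the fundamental theorem -/

/-- **TRAPEZOID IDENTITY**: g with `g′ = g₁`, `g₁′ = g₂` on [a, b] (a ≤ b), g₂ continuous there ⟹
**`(b − a)(g a + g b) = 2∫_a^b g + ∫_a^b (x − a)(b − x)·g₂ x dx`** — the derivative of `Ψ(x) = (x−a)(b−x)g₁ x + (2x − a − b)g x` is
`2g x + (x−a)(b−x)g₂ x`, and `Ψ b − Ψ a = (b − a)(g a + g b)`. [folklore] -/
theorem trapezoid_identity {a b : ℝ} (hab : a ≤ b)
    (hg : ∀ x ∈ Icc a b, HasDerivAt g (g₁ x) x) (hg₁ : ∀ x ∈ Icc a b, HasDerivAt g₁ (g₂ x) x)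
    (hg₂ : ContinuousOn g₂ (Icc a b)) :
    (b - a) * (g a + g b) = 2 * (∫ x in a..b, g x) + ∫ x in a..b, (x - a) * (b - x) * g₂ x := by
  have hgc : ContinuousOn g (Icc a b) := fun x hx => (hg x hx).continuousAt.continuousWithinAt
  have hderiv : ∀ x ∈ uIcc a b, HasDerivAt (fun y => (y - a) * (b - y) * g₁ y + (2 * y - a - b) * g y)
      (2 * g x + (x - a) * (b - x) * g₂ x) x := by
    intro x hx
    rw [uIcc_of_le hab] at hx
    have h1 : HasDerivAt (fun y : ℝ => (y - a) * (b - y)) ((1:ℝ) * (b - x) + (x - a) * (-1)) x := by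
      have ha : HasDerivAt (fun y : ℝ => y - a) 1 x := (hasDerivAt_id x).sub_const a
      have hb : HasDerivAt (fun y : ℝ => b - y) (-1) x := by
        have := (hasDerivAt_id x).const_sub b
        simpa using this
      exact ha.mul hb
    have h2 := h1.mul (hg₁ x hx)
    have h3 : HasDerivAt (fun y : ℝ => 2 * y - a - b) (2:ℝ) x := by
      have := ((hasDerivAt_id x).const_mul 2).sub_const a |>.sub_const b
      simpa using this
    have h4 := h3.mul (hg x hx)
    have h := h2.add h4
    refine h.congr_deriv ?_
    ring
  have hint1 : IntervalIntegrable (fun x => 2 * g x) volume a b :=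
    (continuousOn_const.mul hgc).intervalIntegrable_of_Icc hab
  have hint2 : IntervalIntegrable (fun x => (x - a) * (b - x) * g₂ x) volume a b :=
    (((continuousOn_id.sub continuousOn_const).mul (continuousOn_const.sub continuousOn_id)).mul hg₂).intervalIntegrable_of_Icc hab
  have hftc := intervalIntegral.integral_eq_sub_of_hasDerivAt hderiv (hint1.add hint2)
  rw [intervalIntegral.integral_add hint1 hint2, intervalIntegral.integral_const_mul] at hftc
  have hR : ((b - a) * (b - b) * g₁ b + (2 * b - a - b) * g b) - ((a - a) * (b - a) * g₁ a + (2 * a - a - b) * g a)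
      = (b - a) * (g a + g b) := by ring
  rw [hR] at hftc
  linarith

/-- **TRAPEZOID ERROR**: moreover `|g₂| ≤ C` on [a, b] ⟹ **`|(b − a)(g a + g b)∕2 − ∫_a^b g| ≤ (b − a)³·C∕2`**
(`(x − a)(b − x) ≤ (b − a)²`; the classical constant 1∕12 is not needed). [folklore] -/
theorem trapezoid_error_le {a b C : ℝ} (hab : a ≤ b)
    (hg : ∀ x ∈ Icc a b, HasDerivAt g (g₁ x) x) (hg₁ : ∀ x ∈ Icc a b, HasDerivAt g₁ (g₂ x) x)
    (hg₂ : ContinuousOn g₂ (Icc a b)) (hC : ∀ x ∈ Icc a b, |g₂ x| ≤ C) :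
    |(b - a) * (g a + g b) / 2 - ∫ x in a..b, g x| ≤ (b - a) ^ 3 * C / 2 := by
  have hid := trapezoid_identity hab hg hg₁ hg₂
  have heq : (b - a) * (g a + g b) / 2 - ∫ x in a..b, g x = (∫ x in a..b, (x - a) * (b - x) * g₂ x) / 2 := by
    rw [hid]; ring
  rw [heq, abs_div, abs_of_pos (by norm_num : (0:ℝ) < 2)]
  have hbound : ∀ x ∈ Set.uIoc a b, ‖(x - a) * (b - x) * g₂ x‖ ≤ (b - a) ^ 2 * C := by
    intro x hx
    rw [uIoc_of_le hab] at hx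
    have hxI : x ∈ Icc a b := ⟨hx.1.le, hx.2⟩
    rw [Real.norm_eq_abs, abs_mul, abs_mul, abs_of_nonneg (by linarith [hx.1] : 0 ≤ x - a),
      abs_of_nonneg (by linarith [hx.2] : 0 ≤ b - x)]
    have h1 : (x - a) * (b - x) ≤ (b - a) ^ 2 := by nlinarith [hx.1, hx.2]
    have hC0 : 0 ≤ C := (abs_nonneg _).trans (hC x hxI)
    calc (x - a) * (b - x) * |g₂ x| ≤ (b - a) ^ 2 * C :=
        mul_le_mul h1 (hC x hxI) (abs_nonneg _) (sq_nonneg _)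
      _ = (b - a) ^ 2 * C := rfl
  have h := intervalIntegral.norm_integral_le_of_norm_le_const hbound
  rw [Real.norm_eq_abs, abs_of_nonneg (sub_nonneg.mpr hab)] at h
  calc |∫ x in a..b, (x - a) * (b - x) * g₂ x| / 2 ≤ (b - a) ^ 2 * C * (b - a) / 2 :=
        div_le_div_of_nonneg_right h (by norm_num)
    _ = (b - a) ^ 3 * C / 2 := by ring

/-! ## §2 The left-endpoint rule with its error -/

/-- **LEFT-ENDPOINT IDENTITY**: G with `G′ = G₁` on [a, b] (a ≤ b), G₁ continuous ⟹ **`(b − a)·G a = ∫_a^b G + ∫_a^b (x − b)·G₁ x dx`**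
(derivative of `(x − b)G x`). [folklore] -/
theorem leftEndpoint_identity {a b : ℝ} (hab : a ≤ b)
    (hG : ∀ x ∈ Icc a b, HasDerivAt G (G₁ x) x) (hG₁ : ContinuousOn G₁ (Icc a b)) :
    (b - a) * G a = (∫ x in a..b, G x) + ∫ x in a..b, (x - b) * G₁ x := by
  have hGc : ContinuousOn G (Icc a b) := fun x hx => (hG x hx).continuousAt.continuousWithinAt
  have hderiv : ∀ x ∈ uIcc a b, HasDerivAt (fun y => (y - b) * G y) (G x + (x - b) * G₁ x) x := by
    intro x hx
    rw [uIcc_of_le hab] at hx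
    have h1 : HasDerivAt (fun y : ℝ => y - b) 1 x := (hasDerivAt_id x).sub_const b
    have h := h1.mul (hG x hx)
    refine h.congr_deriv ?_
    ring
  have hint1 : IntervalIntegrable (fun x => G x) volume a b := hGc.intervalIntegrable_of_Icc hab
  have hint2 : IntervalIntegrable (fun x => (x - b) * G₁ x) volume a b :=
    ((continuousOn_id.sub continuousOn_const).mul hG₁).intervalIntegrable_of_Icc hab
  have hftc := intervalIntegral.integral_eq_sub_of_hasDerivAt hderiv (hint1.add hint2)
  rw [intervalIntegral.integral_add hint1 hint2] at hftc
  have hR : (b - b) * G b - (a - b) * G a = (b - a) * G a := by ring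
  rw [hR] at hftc
  linarith

/-- **LEFT-ENDPOINT ERROR**: moreover `|G₁| ≤ C` on [a, b] ⟹ **`|(b − a)·G a − ∫_a^b G| ≤ (b − a)²·C`**. [folklore] -/
theorem leftEndpoint_error_le {a b C : ℝ} (hab : a ≤ b)
    (hG : ∀ x ∈ Icc a b, HasDerivAt G (G₁ x) x) (hG₁ : ContinuousOn G₁ (Icc a b)) (hC : ∀ x ∈ Icc a b, |G₁ x| ≤ C) :
    |(b - a) * G a - ∫ x in a..b, G x| ≤ (b - a) ^ 2 * C := by
  have hid := leftEndpoint_identity hab hG hG₁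
  have heq : (b - a) * G a - ∫ x in a..b, G x = ∫ x in a..b, (x - b) * G₁ x := by rw [hid]; ring
  rw [heq]
  have hbound : ∀ x ∈ Set.uIoc a b, ‖(x - b) * G₁ x‖ ≤ (b - a) * C := by
    intro x hx
    rw [uIoc_of_le hab] at hx
    have hxI : x ∈ Icc a b := ⟨hx.1.le, hx.2⟩
    rw [Real.norm_eq_abs, abs_mul, abs_of_nonpos (by linarith [hx.2] : x - b ≤ 0)]
    have hC0 : 0 ≤ C := (abs_nonneg _).trans (hC x hxI)
    exact mul_le_mul (by linarith [hx.1]) (hC x hxI) (abs_nonneg _) (sub_nonneg.mpr hab)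
  have h := intervalIntegral.norm_integral_le_of_norm_le_const hbound
  rw [Real.norm_eq_abs, abs_of_nonneg (sub_nonneg.mpr hab)] at h
  calc |∫ x in a..b, (x - b) * G₁ x| ≤ (b - a) * C * (b - a) := h
    _ = (b - a) ^ 2 * C := by ring

/-! ## §3 Almost-unit-step sequences -/

/-- `u_j ≥ 1 + j∕2` from `u_0 ≥ 1` and steps ≥ 1∕2. [folklore] -/
theorem step_lower (hu0 : 1 ≤ u 0) (hstep : ∀ j, 1 / 2 ≤ u (j + 1) - u j ∧ u (j + 1) - u j ≤ 2) :
    ∀ j : ℕ, 1 + (j : ℝ) / 2 ≤ u j := by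
  intro j
  induction j with
  | zero => simpa using hu0
  | succ j ih =>
    have h := (hstep j).1
    push_cast
    linarith

/-- `u_j > 0`. [folklore] -/
theorem u_pos (hu0 : 1 ≤ u 0) (hstep : ∀ j, 1 / 2 ≤ u (j + 1) - u j ∧ u (j + 1) - u j ≤ 2) (j : ℕ) : 0 < u j := by
  have := step_lower hu0 hstep j
  have hj : (0:ℝ) ≤ j := Nat.cast_nonneg j
  linarith

/-- `u_j ≥ 1`. [folklore] -/
theorem u_one_le (hu0 : 1 ≤ u 0) (hstep : ∀ j, 1 / 2 ≤ u (j + 1) - u j ∧ u (j + 1) - u j ≤ 2) (j : ℕ) : 1 ≤ u j := by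
  have := step_lower hu0 hstep j
  have hj : (0:ℝ) ≤ j := Nat.cast_nonneg j
  linarith

/-- `u_{j+1} ≤ 3u_j` (step ≤ 2 ≤ 2u_j). [folklore] -/
theorem u_succ_le_three_mul (hu0 : 1 ≤ u 0) (hstep : ∀ j, 1 / 2 ≤ u (j + 1) - u j ∧ u (j + 1) - u j ≤ 2) (j : ℕ) :
    u (j + 1) ≤ 3 * u j := by
  have h1 := (hstep j).2
  have h2 := u_one_le hu0 hstep j
  linarith

/-- u is monotone: `u_i ≤ u_j` for `i ≤ j`. [folklore] -/
theorem u_mono (hstep : ∀ j, 1 / 2 ≤ u (j + 1) - u j ∧ u (j + 1) - u j ≤ 2) {i j : ℕ} (hij : i ≤ j) : u i ≤ u j := by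
  induction j, hij using Nat.le_induction with
  | base => exact le_rfl
  | succ j _ ih =>
    have := (hstep j).1
    linarith

/-- THE CUBIC TELESCOPE: `1∕(9u_j³) ≤ 1∕u_j² − 1∕u_{j+1}²` (`u_{j+1}² − u_j² ≥ (1∕2)·2u_j`, `u_{j+1} ≤ 3u_j`). [folklore] -/
theorem inv_sq_telescope (hu0 : 1 ≤ u 0) (hstep : ∀ j, 1 / 2 ≤ u (j + 1) - u j ∧ u (j + 1) - u j ≤ 2) (j : ℕ) :
    1 / (9 * u j ^ 3) ≤ 1 / u j ^ 2 - 1 / u (j + 1) ^ 2 := by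
  have hj := u_pos hu0 hstep j
  have hj1 := u_pos hu0 hstep (j + 1)
  have hs := (hstep j).1
  have h3 := u_succ_le_three_mul hu0 hstep j
  rw [div_sub_div _ _ (pow_ne_zero 2 hj.ne') (pow_ne_zero 2 hj1.ne'), div_le_div_iff₀ (by positivity) (by positivity)]
  -- 1·(u_j² u_{j+1}²) ≤ (u_{j+1}² − u_j²)·9u_j³
  have hdiff : u j ≤ (1 * u (j + 1) ^ 2 - u j ^ 2 * 1) := by nlinarith
  have hsq : u (j + 1) ^ 2 ≤ 9 * u j ^ 2 := by nlinarith
  calc 1 * (u j ^ 2 * u (j + 1) ^ 2) ≤ u j ^ 2 * (9 * u j ^ 2) := by nlinarith [pow_pos hj 2]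
    _ = u j * (9 * u j ^ 3) := by ring
    _ ≤ (1 * u (j + 1) ^ 2 - u j ^ 2 * 1) * (9 * u j ^ 3) := mul_le_mul_of_nonneg_right hdiff (by positivity)

/-- **`Σ_{K ≤ j < J} 1∕u_j³ ≤ 9∕u_K²`** (telescoping). [folklore] -/
theorem sum_inv_cube_le (hu0 : 1 ≤ u 0) (hstep : ∀ j, 1 / 2 ≤ u (j + 1) - u j ∧ u (j + 1) - u j ≤ 2) {K J : ℕ} (hKJ : K ≤ J) :
    ∑ j ∈ Ico K J, 1 / u j ^ 3 ≤ 9 / u K ^ 2 := by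
  have hterm : ∀ j, 1 / u j ^ 3 ≤ 9 * (1 / u j ^ 2 - 1 / u (j + 1) ^ 2) := by
    intro j
    have h := inv_sq_telescope hu0 hstep j
    have hj := u_pos hu0 hstep j
    rw [div_le_iff₀ (by positivity)] at h
    calc 1 / u j ^ 3 = 1 / (9 * u j ^ 3) * 9 := by field_simp
      _ ≤ (1 / u j ^ 2 - 1 / u (j + 1) ^ 2) * 9 := by
          refine mul_le_mul_of_nonneg_right (inv_sq_telescope hu0 hstep j) (by norm_num)
      _ = 9 * (1 / u j ^ 2 - 1 / u (j + 1) ^ 2) := by ring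
  have htel : ∑ j ∈ Ico K J, (1 / u j ^ 2 - 1 / u (j + 1) ^ 2) = 1 / u K ^ 2 - 1 / u J ^ 2 := by
    induction J, hKJ using Nat.le_induction with
    | base => simp
    | succ J hJ ih => rw [Finset.sum_Ico_succ_top hJ, ih]; ring
  calc ∑ j ∈ Ico K J, 1 / u j ^ 3 ≤ ∑ j ∈ Ico K J, 9 * (1 / u j ^ 2 - 1 / u (j + 1) ^ 2) := Finset.sum_le_sum fun j _ => hterm j
    _ = 9 * (1 / u K ^ 2 - 1 / u J ^ 2) := by rw [← Finset.mul_sum, htel]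
    _ ≤ 9 / u K ^ 2 := by
        have hJ := u_pos hu0 hstep J
        have : 0 ≤ 1 / u J ^ 2 := by positivity
        have e : 9 / u K ^ 2 = 9 * (1 / u K ^ 2) := by ring
        rw [e]; nlinarith

/-- THE QUADRATIC TELESCOPE: `1∕(6u_j²) ≤ 1∕u_j − 1∕u_{j+1}`. [folklore] -/
theorem inv_telescope (hu0 : 1 ≤ u 0) (hstep : ∀ j, 1 / 2 ≤ u (j + 1) - u j ∧ u (j + 1) - u j ≤ 2) (j : ℕ) :
    1 / (6 * u j ^ 2) ≤ 1 / u j - 1 / u (j + 1) := by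
  have hj := u_pos hu0 hstep j
  have hj1 := u_pos hu0 hstep (j + 1)
  have hs := (hstep j).1
  have h3 := u_succ_le_three_mul hu0 hstep j
  rw [div_sub_div _ _ hj.ne' hj1.ne', div_le_div_iff₀ (by positivity) (by positivity)]
  calc 1 * (u j * u (j + 1)) ≤ u j * (3 * u j) := by nlinarith
    _ = (1 / 2) * (6 * u j ^ 2) := by ring
    _ ≤ (1 * u (j + 1) - u j * 1) * (6 * u j ^ 2) := mul_le_mul_of_nonneg_right (by linarith) (by positivity)

/-- **`Σ_{K ≤ j < J} 1∕u_j² ≤ 6∕u_K`**. [folklore] -/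
theorem sum_inv_sq_le (hu0 : 1 ≤ u 0) (hstep : ∀ j, 1 / 2 ≤ u (j + 1) - u j ∧ u (j + 1) - u j ≤ 2) {K J : ℕ} (hKJ : K ≤ J) :
    ∑ j ∈ Ico K J, 1 / u j ^ 2 ≤ 6 / u K := by
  have hterm : ∀ j, 1 / u j ^ 2 ≤ 6 * (1 / u j - 1 / u (j + 1)) := by
    intro j
    have hj := u_pos hu0 hstep j
    calc 1 / u j ^ 2 = 1 / (6 * u j ^ 2) * 6 := by field_simp
      _ ≤ (1 / u j - 1 / u (j + 1)) * 6 := mul_le_mul_of_nonneg_right (inv_telescope hu0 hstep j) (by norm_num)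
      _ = 6 * (1 / u j - 1 / u (j + 1)) := by ring
  have htel : ∑ j ∈ Ico K J, (1 / u j - 1 / u (j + 1)) = 1 / u K - 1 / u J := by
    induction J, hKJ using Nat.le_induction with
    | base => simp
    | succ J hJ ih => rw [Finset.sum_Ico_succ_top hJ, ih]; ring
  calc ∑ j ∈ Ico K J, 1 / u j ^ 2 ≤ ∑ j ∈ Ico K J, 6 * (1 / u j - 1 / u (j + 1)) := Finset.sum_le_sum fun j _ => hterm j
    _ = 6 * (1 / u K - 1 / u J) := by rw [← Finset.mul_sum, htel]
    _ ≤ 6 / u K := by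
        have hJ := u_pos hu0 hstep J
        have : 0 ≤ 1 / u J := by positivity
        have e : 6 / u K = 6 * (1 / u K) := by ring
        rw [e]; nlinarith

/-- `Σ_{K<N} 1∕u_K ≤ 2·H_N` (`u_K ≥ 1 + K∕2 ≥ (K+1)∕2`). [folklore] -/
theorem sum_inv_le_harmonic (hu0 : 1 ≤ u 0) (hstep : ∀ j, 1 / 2 ≤ u (j + 1) - u j ∧ u (j + 1) - u j ≤ 2) (N : ℕ) :
    ∑ K ∈ range N, 1 / u K ≤ 2 * ∑ K ∈ range N, ((K : ℝ) + 1)⁻¹ := by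
  rw [Finset.mul_sum]
  refine Finset.sum_le_sum fun K _ => ?_
  have h := step_lower hu0 hstep K
  have hK : (0:ℝ) < (K : ℝ) + 1 := by positivity
  have huK := u_pos hu0 hstep K
  rw [div_le_iff₀ huK]
  have e : 2 * ((K : ℝ) + 1)⁻¹ * u K = 2 * u K / ((K : ℝ) + 1) := by field_simp
  rw [e, le_div_iff₀ hK]
  linarith

/-- `u_j → ∞`. [folklore] -/
theorem u_tendsto_atTop (hu0 : 1 ≤ u 0) (hstep : ∀ j, 1 / 2 ≤ u (j + 1) - u j ∧ u (j + 1) - u j ≤ 2) :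
    Tendsto u atTop atTop := by
  refine tendsto_atTop_mono (step_lower hu0 hstep) ?_
  have h : Tendsto (fun j : ℕ => (j : ℝ) / 2) atTop atTop :=
    tendsto_natCast_atTop_atTop.atTop_div_const (by norm_num)
  exact tendsto_atTop_add_const_left _ _ h

end

end Summit.QuantumFields.BalabanUV.Beta.EriceFlowEnclosureUnitStepTailLaw
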